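import Summits.Ventures.PercRepro.ThreeBlock

/-!
# Three-block maps with inert coordinates

`ThreeBlock.lean` needs the three blocks to cover the coordinates. Here the coordinates may also
contain an **inert** part `F`: the cell of a configuration depends only on its trace outside `F`
(`c (ω ⊓ Fᶜ) = c ω`). For a graph map this is the case when the edges of `F` never affect the
connectivity of the terminals (pendant edges, edges of terminal-free components).

The block-trace injection of `ThreeBlock.lean` still works: for a bad `ω` of type `(i, j)` the
trace `P = ω ∖ M i` lies in `M (thirdBlock i j) ⊔ F`; its part outside `F` is nonempty and lies in
the third block, so `c P = c (P ⊓ Fᶜ) = ⊥`, while `c Pᶜ = ⊤` as before; and `P` determines `ω`. Hence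
`crossCount + 1 ≤ topBotCount` (`crossCount_add_one_le_topBotCount_of_threeBlockInert`).
-/

namespace PercRepro

open Finset

variable {S : Type} [Fintype S] [DecidableEq S]

/-- **Three-block structure with an inert part `F`**: three pairwise disjoint blocks and an inert
part `F` disjoint from them, covering the coordinates; `M i` in the crossing cell `x_i`; every
member of the crossing cell `x_i` contains `M i`; the cell of a configuration depends only on its
trace outside `F`. -/
structure ThreeBlockInert (c : Config S → Setoid (Fin 4)) (M : Fin 3 → Config S) (F : Config S) :
    Prop where
  sup_eq_top : M 0 ⊔ M 1 ⊔ M 2 ⊔ F = ⊤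
  inf_eq_bot : ∀ {i j : Fin 3}, i ≠ j → M i ⊓ M j = ⊥
  inf_F_eq_bot : ∀ i, M i ⊓ F = ⊥
  cell : ∀ i, c (M i) = cross4 i
  le_of_eq : ∀ i ω, c ω = cross4 i → M i ≤ ω
  inert : ∀ ω, c (ω ⊓ Fᶜ) = c ω

section Main

variable {c : Config S → Setoid (Fin 4)} {M : Fin 3 → Config S} {F : Config S}

omit [Fintype S] [DecidableEq S] in
/-- A three-block map is a three-block map with the inert part `⊥`. -/
theorem ThreeBlock.toInert (hM : ThreeBlock c M) : ThreeBlockInert c M ⊥ where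
  sup_eq_top := by rw [sup_bot_eq, hM.sup_eq_top]
  inf_eq_bot := hM.inf_eq_bot
  inf_F_eq_bot := fun _ => inf_bot_eq _
  cell := hM.cell
  le_of_eq := hM.le_of_eq
  inert := fun ω => by rw [compl_bot, inf_top_eq]

omit [Fintype S] [DecidableEq S] in
/-- The blocks in the order `i, j, thirdBlock i j` together with `F` cover the coordinates. -/
theorem ThreeBlockInert.sup_third (hM : ThreeBlockInert c M F) {i j : Fin 3} (h : i < j) :
    M i ⊔ M j ⊔ M (thirdBlock i j) ⊔ F = ⊤ := by
  rw [← hM.sup_eq_top]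
  rcases lt_cases_fin3 h with ⟨rfl, rfl⟩ | ⟨rfl, rfl⟩ | ⟨rfl, rfl⟩
  · rw [show thirdBlock 0 1 = 2 by decide]
  · rw [show thirdBlock 0 2 = 1 by decide]; ac_rfl
  · rw [show thirdBlock 1 2 = 0 by decide]; ac_rfl

omit [Fintype S] [DecidableEq S] in
/-- Each block lies outside the inert part. -/
theorem ThreeBlockInert.le_compl_F (hM : ThreeBlockInert c M F) (i : Fin 3) : M i ≤ Fᶜ := by
  rw [le_compl_iff_disjoint_right, disjoint_iff]
  exact hM.inf_F_eq_bot i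

omit [Fintype S] [DecidableEq S] in
/-- For a bad `ω` of type `(i, j)`, no block other than `M i` lies below `ω`. -/
theorem ThreeBlockInert.not_le_of_ne (hM : ThreeBlockInert c M F) (hc : Monotone c)
    {ω : Config S} {i : Fin 3} (hω : c ω = cross4 i) {l : Fin 3} (hl : l ≠ i) : ¬ M l ≤ ω := by
  intro h
  have := hc h
  rw [hM.cell l, hω] at this
  exact cross4_not_le_of_ne' hl this

omit [Fintype S] [DecidableEq S] in
/-- The trace of a bad `ω` of type `(i, j)` lies in the third block together with `F`. -/
theorem ThreeBlockInert.sdiff_le_third (hM : ThreeBlockInert c M F) {ω : Config S}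
    {i j : Fin 3} (hij : i < j) (hj : c ωᶜ = cross4 j) :
    ω \ M i ≤ M (thirdBlock i j) ⊔ F := by
  have hMj : M j ≤ ωᶜ := hM.le_of_eq j ωᶜ hj
  have hdisj : ω ⊓ M j = ⊥ := by
    rw [← le_bot_iff]
    calc ω ⊓ M j ≤ ω ⊓ ωᶜ := inf_le_inf_left ω hMj
      _ = ⊥ := inf_compl_eq_bot
  have hle : ω ≤ M i ⊔ (M (thirdBlock i j) ⊔ F) := by
    have h1 : ω = ω ⊓ (M i ⊔ M j ⊔ M (thirdBlock i j) ⊔ F) := by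
      rw [hM.sup_third hij, inf_top_eq]
    calc ω = ω ⊓ (M i ⊔ M j ⊔ M (thirdBlock i j) ⊔ F) := h1
      _ = ω ⊓ M i ⊔ ω ⊓ M j ⊔ ω ⊓ M (thirdBlock i j) ⊔ ω ⊓ F := by
          rw [inf_sup_left, inf_sup_left, inf_sup_left]
      _ = ω ⊓ M i ⊔ ω ⊓ M (thirdBlock i j) ⊔ ω ⊓ F := by rw [hdisj, sup_bot_eq]
      _ ≤ M i ⊔ M (thirdBlock i j) ⊔ F := sup_le_sup (sup_le_sup inf_le_right inf_le_right) inf_le_right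
      _ = M i ⊔ (M (thirdBlock i j) ⊔ F) := sup_assoc _ _ _
  calc ω \ M i ≤ (M i ⊔ (M (thirdBlock i j) ⊔ F)) \ M i := sdiff_le_sdiff_right hle
    _ = (M (thirdBlock i j) ⊔ F) \ M i := sup_sdiff_left_self
    _ ≤ M (thirdBlock i j) ⊔ F := sdiff_le

omit [Fintype S] [DecidableEq S] in
/-- The part of the trace outside `F` lies in the third block. -/
theorem ThreeBlockInert.sdiff_inf_compl_le_third (hM : ThreeBlockInert c M F) {ω : Config S}
    {i j : Fin 3} (hij : i < j) (hj : c ωᶜ = cross4 j) :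
    (ω \ M i) ⊓ Fᶜ ≤ M (thirdBlock i j) := by
  calc (ω \ M i) ⊓ Fᶜ ≤ (M (thirdBlock i j) ⊔ F) ⊓ Fᶜ :=
        inf_le_inf_right _ (hM.sdiff_le_third hij hj)
    _ = M (thirdBlock i j) ⊓ Fᶜ := by rw [inf_sup_right, inf_compl_eq_bot, sup_bot_eq]
    _ ≤ M (thirdBlock i j) := inf_le_left

omit [Fintype S] [DecidableEq S] in
/-- On a bad `ω` of type `(i, j)` the block-trace map is the complement of `ω ∖ M i`. -/
theorem ThreeBlockInert.blockTrace_eq (hM : ThreeBlockInert c M F) (hc : Monotone c)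
    {ω : Config S} {i : Fin 3} (hi : c ω = cross4 i) : blockTrace M ω = (ω \ M i)ᶜ := by
  have hne : ∀ l, l ≠ i → ¬ M l ≤ ω := fun l hl => hM.not_le_of_ne hc hi hl
  unfold blockTrace
  rw [blocksBelow_eq (hM.le_of_eq i ω hi) hne]

/-- The trace of a bad configuration is the `⊥`-member of a good pair. -/
theorem ThreeBlockInert.blockTrace_mem_goodSet (hM : ThreeBlockInert c M F) (hc : Monotone c)
    {ω : Config S} (hω : ω ∈ badSet cross4 c) : blockTrace M ω ∈ goodSet c := by
  classical
  obtain ⟨-, i, j, hij, hi, hj⟩ := Finset.mem_filter.1 hω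
  rw [hM.blockTrace_eq hc hi]
  refine Finset.mem_filter.2 ⟨Finset.mem_univ _, ?_, ?_⟩
  · refine top_unique ?_
    rw [← cross4_sup_eq_top hij.ne]
    have hMj : M j ≤ ωᶜ := hM.le_of_eq j ωᶜ hj
    have h1 : M i ≤ (ω \ M i)ᶜ := by
      rw [sdiff_eq, compl_inf, compl_compl]
      exact le_sup_right
    have h2 : M j ≤ (ω \ M i)ᶜ := by
      rw [sdiff_eq, compl_inf, compl_compl]
      exact le_sup_of_le_left hMj
    refine sup_le ?_ ?_
    · rw [← hM.cell i]; exact hc h1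
    · rw [← hM.cell j]; exact hc h2
  · rw [compl_compl, ← hM.inert]
    refine le_bot_iff.1 ?_
    rw [← cross4_inf_eq_bot (thirdBlock_ne hij).1]
    refine le_inf ?_ ?_
    · rw [← hi]; exact hc (inf_le_left.trans sdiff_le)
    · rw [← hM.cell (thirdBlock i j)]; exact hc (hM.sdiff_inf_compl_le_third hij hj)

omit [Fintype S] [DecidableEq S] in
/-- The part of the trace outside `F` is nonempty: otherwise `ω ⊓ Fᶜ = M i` and `ωᶜ` contains the two
other blocks, so `c ωᶜ = ⊤`. -/
theorem ThreeBlockInert.sdiff_inf_compl_ne_bot (hM : ThreeBlockInert c M F) (hc : Monotone c)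
    {ω : Config S} {i j : Fin 3} (hij : i < j) (hi : c ω = cross4 i) (hj : c ωᶜ = cross4 j) :
    (ω \ M i) ⊓ Fᶜ ≠ ⊥ := by
  intro h0
  have hk := thirdBlock_ne hij
  have hMi : M i ≤ ω := hM.le_of_eq i ω hi
  -- `ω ⊓ Fᶜ ≤ M i`
  have hωF : ω ⊓ Fᶜ ≤ M i := by
    have : ω ⊓ Fᶜ = (M i ⊔ ω \ M i) ⊓ Fᶜ := by rw [sup_sdiff_cancel_right hMi]
    rw [this, inf_sup_right, h0, sup_bot_eq]
    exact inf_le_left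
  -- hence the third block lies in `ωᶜ`
  have hkc : M (thirdBlock i j) ≤ ωᶜ := by
    rw [le_compl_iff_disjoint_right, disjoint_iff, ← le_bot_iff]
    calc M (thirdBlock i j) ⊓ ω = M (thirdBlock i j) ⊓ (ω ⊓ Fᶜ) := by
          rw [← inf_assoc, inf_right_comm, inf_of_le_left (hM.le_compl_F _)]
      _ ≤ M (thirdBlock i j) ⊓ M i := inf_le_inf_left _ hωF
      _ = ⊥ := hM.inf_eq_bot hk.1.symm
  have hjc : M j ≤ ωᶜ := hM.le_of_eq j ωᶜ hj
  have htop : c ωᶜ = ⊤ := by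
    refine top_unique ?_
    rw [← cross4_sup_eq_top hk.2]
    refine sup_le ?_ ?_
    · rw [← hM.cell j]; exact hc hjc
    · rw [← hM.cell (thirdBlock i j)]; exact hc hkc
  rw [hj] at htop
  have := cross4_inf_eq_bot hk.2
  rw [htop, top_inf_eq] at this
  exact cross4_ne_bot (thirdBlock i j) this

/-- The block-trace map is injective on the bad set. -/
theorem ThreeBlockInert.blockTrace_injOn (hM : ThreeBlockInert c M F) (hc : Monotone c) :
    Set.InjOn (blockTrace M) (badSet cross4 c : Set (Config S)) := by
  classical
  intro ω₁ hω₁ ω₂ hω₂ heq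
  obtain ⟨-, i₁, j₁, hij₁, hi₁, hj₁⟩ := Finset.mem_filter.1 (Finset.mem_coe.1 hω₁)
  obtain ⟨-, i₂, j₂, hij₂, hi₂, hj₂⟩ := Finset.mem_filter.1 (Finset.mem_coe.1 hω₂)
  rw [hM.blockTrace_eq hc hi₁, hM.blockTrace_eq hc hi₂, compl_inj_iff] at heq
  have hP1 : (ω₁ \ M i₁) ⊓ Fᶜ ≤ M (thirdBlock i₁ j₁) := hM.sdiff_inf_compl_le_third hij₁ hj₁
  have hP2 : (ω₂ \ M i₂) ⊓ Fᶜ ≤ M (thirdBlock i₂ j₂) := hM.sdiff_inf_compl_le_third hij₂ hj₂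
  have hne : (ω₁ \ M i₁) ⊓ Fᶜ ≠ ⊥ := hM.sdiff_inf_compl_ne_bot hc hij₁ hi₁ hj₁
  have hk : thirdBlock i₁ j₁ = thirdBlock i₂ j₂ := by
    by_contra hkk
    apply hne
    rw [← le_bot_iff, ← hM.inf_eq_bot hkk]
    exact le_inf hP1 (heq ▸ hP2)
  obtain ⟨rfl, -⟩ := eq_of_thirdBlock_eq hij₁ hij₂ hk
  have h1 : ω₁ = M i₁ ⊔ ω₁ \ M i₁ := (sup_sdiff_cancel_right (hM.le_of_eq i₁ ω₁ hi₁)).symm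
  have h2 : ω₂ = M i₁ ⊔ ω₂ \ M i₁ := (sup_sdiff_cancel_right (hM.le_of_eq i₁ ω₂ hi₂)).symm
  rw [h1, h2, heq]

/-- `⊤` is a good member (the pair `{∅, ⊤}`). -/
theorem ThreeBlockInert.top_mem_goodSet (hM : ThreeBlockInert c M F) (hc : Monotone c) :
    (⊤ : Config S) ∈ goodSet c := by
  classical
  refine Finset.mem_filter.2 ⟨Finset.mem_univ _, ?_, ?_⟩
  · refine top_unique ?_
    rw [← cross4_sup_eq_top (show (0 : Fin 3) ≠ 1 by decide)]
    refine sup_le ?_ ?_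
    · rw [← hM.cell 0]; exact hc le_top
    · rw [← hM.cell 1]; exact hc le_top
  · rw [compl_top]
    refine le_bot_iff.1 ?_
    rw [← cross4_inf_eq_bot (show (0 : Fin 3) ≠ 1 by decide)]
    refine le_inf ?_ ?_
    · rw [← hM.cell 0]; exact hc bot_le
    · rw [← hM.cell 1]; exact hc bot_le

/-- The block-trace of a bad configuration is never `⊤`. -/
theorem ThreeBlockInert.blockTrace_ne_top (hM : ThreeBlockInert c M F) (hc : Monotone c)
    {ω : Config S} (hω : ω ∈ badSet cross4 c) : blockTrace M ω ≠ ⊤ := by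
  classical
  obtain ⟨-, i, j, hij, hi, hj⟩ := Finset.mem_filter.1 hω
  rw [hM.blockTrace_eq hc hi, Ne, compl_eq_top]
  intro h0
  apply hM.sdiff_inf_compl_ne_bot hc hij hi hj
  rw [h0, bot_inf_eq]

/-- **Lemma B for three-block maps with inert coordinates, with the slack `1` of `{∅, ⊤}`**. -/
theorem crossCount_add_one_le_topBotCount_of_threeBlockInert (c : Config S → Setoid (Fin 4))
    (hc : Monotone c) (M : Fin 3 → Config S) (F : Config S) (hM : ThreeBlockInert c M F) :
    crossCount cross4 c + 1 ≤ topBotCount c := by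
  classical
  rw [crossCount_eq_card_badSet, topBotCount_eq_card_goodSet]
  have hmaps : ∀ ω ∈ badSet cross4 c, blockTrace M ω ∈ (goodSet c).erase ⊤ := fun ω hω =>
    Finset.mem_erase.2 ⟨hM.blockTrace_ne_top hc hω, hM.blockTrace_mem_goodSet hc hω⟩
  have h1 : (badSet cross4 c).card ≤ ((goodSet c).erase ⊤).card :=
    Finset.card_le_card_of_injOn (blockTrace M) hmaps (hM.blockTrace_injOn hc)
  have h2 : ((goodSet c).erase ⊤).card + 1 = (goodSet c).card :=
    Finset.card_erase_add_one (hM.top_mem_goodSet hc)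
  omega

/-- **Lemma B for three-block maps with inert coordinates.** -/
theorem crossCount_le_topBotCount_of_threeBlockInert (c : Config S → Setoid (Fin 4))
    (hc : Monotone c) (M : Fin 3 → Config S) (F : Config S) (hM : ThreeBlockInert c M F) :
    crossCount cross4 c ≤ topBotCount c :=
  Nat.le_of_succ_le (crossCount_add_one_le_topBotCount_of_threeBlockInert c hc M F hM)

end Main

end PercRepro
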